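/-
Copyright (c) 2026 the pub-hodgecm-mathlib formalisation cell (harness21).  Track B «K2-LIT» prover seat hodgecm-mathlib-K2E4-p14 (g4), 2026-09-04:
‹S› ROAD J, road (d-w) of K2E3-p03 (g3), brick (C2b-ii) «`[Λ¹ : Λ¹(4Λ)] = q^{6m−⌊d∕2⌋}`», FILE A1b — the two reduced-norm images of the order unit group `Λ^×` of the anisotropic
plane `⟨1, −ξ⟩` at a WILD ramified quadratic datum: `nrd(Λ^×) = 𝒪_F^×` and `nrd(1 + 4Λ) = U_F^{(2m+⌊d∕2⌋)}`.
-/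
import Summits.HodgeConjecture.HodgeConjecture.Theorems.K2E3WildOrderUnitGroup    -- ★ FILE A1 (this seat): the order unit group `Λ^×`, `exists_mem_diag`, `det_fixed_of_mem`, shape algebra
import Literature.NumberTheory.LocalFields.WildQuadraticDatumNormOneQuotient      -- ★ `two_le_of_v_two_lt_one` (a wild datum has `d ≥ 2`)
import HarnessLib

/-!
# Reduced-norm images of the order `Λ = 𝒪_E ⊕ 𝒪_E·j` of the anisotropic plane `⟨1,−ξ⟩` at a wild ramified quadratic datum: `nrd(Λ^×) = 𝒪_F^×`, `nrd(1+4Λ) = U_F^{(2m+⌊d∕2⌋)}`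
# (Serre, *Local Fields* V §3; Riehm 1970; Vignéras LNM 800 II §1)

Cell `pub/hodgecm-mathlib`, Track B «K2-LIT», crux H413 = `stmt-HodgeConjecture-24833` (supports-only, `--as helper`, count-neutral); ‹S› ROAD J, road (d-w) of ‹J3› v2
(owner K2E3-p03 (g3)); letter (C2) `sig_K2E3WildAnisotropicResidualCount`, brick **(C2b-ii) `[Λ¹ : Λ¹(4Λ)] = q^{6m−⌊d∕2⌋}`** (this seat; road owner 2026-09-04T03:36:47Z (2), dealer K2E3-plan
(g3) 03:38:10Z (R2)), FILE A1b of the road `[ker f : ker f ∩ N] = [G : N] ∕ [f(G) : f(N)]` (census 03:39:19Z, owner «=» 03:41:14Z).  THEOREMS ONLY (no `def`, no `instance`, no notation,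
no named fact, no `sorry`).  Currency = ★ FILE A1 (`K2E3WildOrderUnitGroup`): ONE complete field `K = E` with involution `σ`, `IsRamifiedQuadraticDatum σ ϖ d t`, `[CompleteSpace K]`,
`[Finite 𝓀[K]]`, `ξ` a `σ`-fixed unit; the order unit group `G = Λ^× ≤ GL₂(K)` by its MEMBERSHIP LETTER (shape `[[a, ξσc],[c, σa]]`, `a, c` integral, `|det| = 1`).
* §3 **`exists_mem_det_not_isNorm`** (wild, `|2| < 1`): ONE non-norm determinant `t = det M(1, ϖ^{d−1}a) = 1 − ξ·(ϖσϖ)^{d−1}·a²` — `a` a fixed integer with `a² ≡ −e∕ξ (mod 𝔪)`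
  (★ `exists_valued_mul_self_sub_lt_one_of_finite_residueField`, residue characteristic `2`), `e = (ζ − 1)∕(ϖσϖ)^{d−1}` for the ★ break-level non-norm `ζ ≡ 1 (mod ϖ^{2d−2})`
  (`exists_fixed_unit_not_norm_v_sub_one_le`); then `|ζ − t| ≤ exp(−2d)`, `ζ∕t` is a ★ deep norm (`exists_mul_map_eq_of_fixed_of_v_sub_one_le_pred`), so `t ∉ N`;
  **`exists_mem_det_eq_of_fixed_unit`**: `det(Λ^×) = 𝒪_F^×` — `N(𝒪_E^×)` by the torus `diag(z, σz)`, the other coset through `t` and the ★ index-two dichotomy (`exists_nonnorm_dichotomy`).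
  This is also (C2b-i)'s input «`nrd(Λ^×) = 𝒪_v^×`» (K2E4-p07 (g4), road owner 03:41:14Z (2)).
* §4 **`valued_det_sub_one_le_of_level`**: for `|2| = |ϖ|^{2m}`, `nrd(G_{4m}) ⊆ U_F^{(2m+⌊d∕2⌋)}` (E-depth `4m + 2⌊d∕2⌋`) — ★ trace depth `Tr 𝔭_E^{4m} ⊆ 𝔭_F^{2m+⌊d∕2⌋}` (`v_add_map_le_exp`) and
  `|xσx|, |ξcσc| ≤ exp(−8m)` (`d ≤ t + 1`, ★ `d_le_succ_t`); **`exists_mem_level_det_eq_of_fixed_unit_level`** (`m ≥ 1`): `⊇` already on the torus `c = 0` by Serre's `ψ(n) = 2n − d + 1`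
  (★ `exists_mul_map_eq_of_isRamifiedQuadraticDatum`; `4m + 2⌊d∕2⌋ ≥ 2d`, `4m + 2⌊d∕2⌋ + 1 − d ≥ 4m`).  So the ⌊d∕2⌋ of the letter is EXACTLY the trace depth at `j = 4m`.
HONEST LABEL: HC_CM is proved only modulo the 7 printed citations (2 remaining named inputs: hLiu418 = `stmt-HodgeConjecture-24832`, h413 = `stmt-HodgeConjecture-24833`) until rung 0
closes; count-neutral local algebra; (C2b-ii)∕(C2)∕(W3) are NOT proved in this file.

## References
* [Serre1979] J.-P. Serre, *Local Fields*, GTM 67 (1979), Ch. V §3 Prop. 5, Cor. 2–3 (norm groups and their filtration, totally ramified case), Ch. III §3 Prop. 7 (traces), Ch. XV §2.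
* [Riehm1970] C. Riehm, *The norm 1 group of a 𝔭-adic division algebra*, Amer. J. Math. 92 (1970), §§1–2 (norm-one filtrations of local orders).
* [VignerasLNM800] M.-F. Vignéras, *Arithmétique des algèbres de quaternions*, LNM 800 (1980), Ch. II §1 (orders and reduced norms in a local quaternion algebra).
* [Rogawski1990] J. D. Rogawski, *Automorphic Representations of Unitary Groups in Three Variables*, Ann. of Math. Stud. 123 (1990), §3.8 p. 33 (`SU(⟨1,−ξ⟩) = D¹`).
-/

set_option autoImplicit false
set_option linter.dupNamespace false

noncomputable section

open WithZero Matrix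
open scoped Valued MatrixGroups
open Literature.NumberTheory.Automorphic.UnitaryThreeFourFrame (IsRamifiedQuadraticDatum)
open Literature.NumberTheory.LocalFields.WildQuadraticDatum
open Literature.NumberTheory.LocalFields (isAdicComplete_valuedInteger_of_completeSpace exists_valued_mul_self_sub_lt_one_of_finite_residueField)
open Summit.HodgeConjecture.HodgeConjecture.Cruxes.H413.K2E3WildOrderUnitGroup

namespace Summit.HodgeConjecture.HodgeConjecture.Cruxes.H413.K2E3WildOrderUnitGroupNormImage

/-! ## §3 The reduced-norm image of `Λ^×` is ALL of `𝒪_F^×` (one explicit non-norm determinant + the index-two dichotomy) -/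

section DetImage

variable {K : Type} [Field K] [Valued K ℤᵐ⁰] [CompleteSpace K] [Finite 𝓀[K]] {σ : K →+* K} {ϖ ξ : K} {d t : ℕ}

/-- **A NON-NORM DETERMINANT IN `Λ^×`** at a WILD datum (`|2| < 1`): `g₀ = M(1, ϖ^{d−1}·a)` with `det g₀ = 1 − ξ·(ϖσϖ)^{d−1}·a² =: t` NOT a norm, where `a` is a fixed integer with
`a² ≡ −e∕ξ (mod 𝔪)`, `e = (ζ − 1)∕(ϖσϖ)^{d−1}` and `ζ ≡ 1 (mod ϖ^{2d−2})` the ★ break-level non-norm: then `|ζ − t| ≤ exp(−2d)`, so `ζ∕t` is a ★ deep norm and `t` is not.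
[cite: Serre1979, Ch. V §3 Prop. 5 (iii), Cor. 3] [cite: Riehm1970, §2] -/
theorem exists_mem_det_not_isNorm (hD : IsRamifiedQuadraticDatum σ ϖ d t) (h2v : Valued.v (2 : K) < 1) (hσξ : σ ξ = ξ) (hξ1 : Valued.v ξ = 1)
    {G : Subgroup (GL (Fin 2) K)}
    (hG : ∀ g : GL (Fin 2) K, g ∈ G ↔
      ((g : Matrix (Fin 2) (Fin 2) K) 0 1 = ξ * σ ((g : Matrix (Fin 2) (Fin 2) K) 1 0) ∧ (g : Matrix (Fin 2) (Fin 2) K) 1 1 = σ ((g : Matrix (Fin 2) (Fin 2) K) 0 0) ∧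
        Valued.v ((g : Matrix (Fin 2) (Fin 2) K) 0 0) ≤ 1 ∧ Valued.v ((g : Matrix (Fin 2) (Fin 2) K) 1 0) ≤ 1 ∧ Valued.v (g : Matrix (Fin 2) (Fin 2) K).det = 1)) :
    ∃ g : GL (Fin 2) K, g ∈ G ∧ ¬ ∃ z : K, z * σ z = (g : Matrix (Fin 2) (Fin 2) K).det := by
  have hD' := hD
  obtain ⟨hσ, hvσ, hϖ, hfix, hd, -, ht⟩ := hD'
  have hϖ1 : exp (-1 : ℤ) < (1 : ℤᵐ⁰) := by rw [← exp_zero, exp_lt_exp]; norm_num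
  have h2d : 2 ≤ d := two_le_of_v_two_lt_one hσ hvσ hfix hϖ hd ht h2v
  have hξ0 : ξ ≠ 0 := fun h => by rw [h, map_zero] at hξ1; exact zero_ne_one hξ1
  -- the break-level non-norm `ζ ≡ 1 (mod ϖ^{2d−2})`
  obtain ⟨ζ, hσζ, hζ1, hζlev, hζN⟩ := exists_fixed_unit_not_norm_v_sub_one_le hD h2v
  -- `π^{d−1}`, `π = ϖσϖ`
  have hπn : Valued.v ((ϖ * σ ϖ) ^ (d - 1)) = exp (-(2 * ((d - 1 : ℕ) : ℤ))) := v_normVarpi_pow hvσ hϖ (d - 1)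
  have hπn0 : (ϖ * σ ϖ) ^ (d - 1) ≠ 0 := (Valuation.ne_zero_iff _).1 (by rw [hπn]; exact exp_ne_zero)
  have hσπn : σ ((ϖ * σ ϖ) ^ (d - 1)) = (ϖ * σ ϖ) ^ (d - 1) := by rw [map_pow, map_mul_map hσ]
  -- `e := (ζ − 1)∕π^{d−1}`, `W := −e∕ξ`
  set e : K := (ζ - 1) / (ϖ * σ ϖ) ^ (d - 1) with he
  have hσe : σ e = e := by rw [he, map_div₀, map_sub, map_one, hσζ, hσπn]
  have he1 : Valued.v e ≤ 1 := by rw [he, map_div₀, hπn, div_le_iff₀ (by exact exp_pos), one_mul]; exact hζlev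
  have heπ : e * (ϖ * σ ϖ) ^ (d - 1) = ζ - 1 := div_mul_cancel₀ _ hπn0
  set W : K := -(e / ξ) with hW
  have hσW : σ W = W := by rw [hW, map_neg, map_div₀, hσe, hσξ]
  have hW1 : Valued.v W ≤ 1 := by rw [hW, Valuation.map_neg, map_div₀, hξ1, div_one]; exact he1
  -- a fixed integer `a` with `a² ≡ W (mod 𝔪)`, hence `|a² − W| ≤ exp(−2)`
  obtain ⟨x, hx1, hxW⟩ := exists_valued_mul_self_sub_lt_one_of_finite_residueField h2v W hW1
  obtain ⟨a, hσa, ha1, hxa⟩ := exists_fixed_v_sub_le hσ hfix hϖ hd hx1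
  have hkey : Valued.v (a * a - W) < 1 := by
    have h1 : Valued.v ((a - x) * (a + x)) < 1 := by
      rw [map_mul]
      calc Valued.v (a - x) * Valued.v (a + x) ≤ Valued.v (a - x) * 1 := mul_le_mul_right (Valued.v.map_add_le ha1 hx1) _
        _ < 1 := by rw [mul_one, ← neg_sub, Valuation.map_neg]; exact lt_of_le_of_lt hxa hϖ1
    have : a * a - W = (x * x - W) + (a - x) * (a + x) := by ring
    rw [this]
    exact Valued.v.map_add_lt hxW h1
  have hkey' : Valued.v (a * a - W) ≤ exp (-2 : ℤ) := by
    have hσk : σ (a * a - W) = a * a - W := by rw [map_sub, map_mul, hσa, hσW]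
    have := v_le_exp_of_fixed_of_v_lt hfix hσk (m := 0) (by rw [mul_zero, exp_zero]; exact hkey)
    simpa using this
  -- `t := 1 − ξ·π^{d−1}·a²`, a unit with `|ζ − t| ≤ exp(−2d)`
  set tt : K := 1 - ξ * ((ϖ * σ ϖ) ^ (d - 1) * (a * a)) with htt
  have hσtt : σ tt = tt := by rw [htt, map_sub, map_one, map_mul, hσξ, map_mul, hσπn, map_mul, hσa]
  have hsmall : Valued.v (ξ * ((ϖ * σ ϖ) ^ (d - 1) * (a * a))) < 1 := by
    rw [map_mul, hξ1, one_mul, map_mul, hπn, map_mul]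
    calc exp (-(2 * ((d - 1 : ℕ) : ℤ))) * (Valued.v a * Valued.v a) ≤ exp (-(2 * ((d - 1 : ℕ) : ℤ))) * 1 :=
          mul_le_mul_right (mul_le_one' ha1 ha1) _
      _ < 1 := by rw [mul_one, ← exp_zero, exp_lt_exp]; push_cast [Nat.cast_sub (by omega : 1 ≤ d)]; omega
  have htt1 : Valued.v tt = 1 := by rw [htt]; exact Valuation.map_one_sub_of_lt _ hsmall
  have htt0 : tt ≠ 0 := fun h => by rw [h, map_zero] at htt1; exact zero_ne_one htt1
  have hξW : ξ * W = -e := by rw [hW]; field_simp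
  have hdiff : ζ - tt = (ϖ * σ ϖ) ^ (d - 1) * (ξ * (a * a - W)) := by
    rw [mul_sub ξ, hξW, htt]; linear_combination -heπ
  have hζtt : Valued.v (ζ * tt⁻¹ - 1) ≤ Valued.v ϖ ^ (2 * d) := by
    rw [show ζ * tt⁻¹ - 1 = (ζ - tt) * tt⁻¹ by field_simp, map_mul, map_inv₀, htt1, inv_one, mul_one, hdiff, map_mul, hπn, map_mul, hξ1, one_mul,
      v_varpi_pow hϖ]
    calc exp (-(2 * ((d - 1 : ℕ) : ℤ))) * Valued.v (a * a - W) ≤ exp (-(2 * ((d - 1 : ℕ) : ℤ))) * exp (-2 : ℤ) := mul_le_mul_right hkey' _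
      _ = exp (-((2 * d : ℕ) : ℤ)) := by rw [← exp_add]; congr 1; push_cast [Nat.cast_sub (by omega : 1 ≤ d)]; ring
  -- `ζ∕t` is a deep norm, so `t` is not a norm
  obtain ⟨w, hw⟩ := exists_mul_map_eq_of_fixed_of_v_sub_one_le_pred hD (u := ζ * tt⁻¹) (by rw [map_mul, map_inv₀, hσζ, hσtt]) (n := 2 * d) (by omega) hζtt
  have httN : ¬ ∃ y : K, y * σ y = tt := by
    rintro ⟨y, hy⟩
    refine hζN ⟨w * y, ?_⟩
    rw [← mul_map_mul_map, hw, hy, inv_mul_cancel_right₀ htt0]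
  -- the element `g₀ = M(1, ϖ^{d−1}·a)`
  set M0 : Matrix (Fin 2) (Fin 2) K := !![1, ξ * σ (ϖ ^ (d - 1) * a); ϖ ^ (d - 1) * a, 1] with hM0
  have hM0det : M0.det = tt := by
    rw [hM0, Matrix.det_fin_two_of, htt, map_mul, map_pow, hσa, mul_pow]; ring
  have hM0det0 : M0.det ≠ 0 := by rw [hM0det]; exact htt0
  refine ⟨Matrix.GeneralLinearGroup.mkOfDetNeZero M0 hM0det0, (hG _).2 ⟨?_, ?_, ?_, ?_, ?_⟩, by
    change ¬ ∃ z : K, z * σ z = M0.det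
    rw [hM0det]; exact httN⟩
  · change M0 0 1 = ξ * σ (M0 1 0); simp [hM0]
  · change M0 1 1 = σ (M0 0 0); simp [hM0]
  · change Valued.v (M0 0 0) ≤ 1; simp [hM0]
  · change Valued.v (M0 1 0) ≤ 1
    simp only [hM0, Matrix.of_apply, Matrix.cons_val', Matrix.cons_val_zero, Matrix.cons_val_one, Matrix.cons_val_fin_one, map_mul, map_pow, hϖ]
    calc exp (-1 : ℤ) ^ (d - 1) * Valued.v a ≤ 1 * 1 := mul_le_mul' (pow_le_one' hϖ1.le _) ha1
      _ = 1 := one_mul 1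
  · change Valued.v M0.det = 1; rw [hM0det, htt1]

/-- **`det(Λ^×) = 𝒪_F^×`**: every `σ`-fixed unit `u` is the determinant of some `g ∈ Λ^×` (wild datum, `|2| < 1`).  If `u = zσz` take `diag(z, σz)`; otherwise `u∕t` with the non-norm
determinant `t` of `exists_mem_det_not_isNorm` is a norm by the ★ index-two dichotomy (`exists_nonnorm_dichotomy`), and `diag(z,σz)·g₀` does it.  (= (C2b-i)'s input
«`nrd(Λ^×) = 𝒪_v^×`», K2E4-p07 (g4).) [cite: Serre1979, Ch. V §3 Cor. 3] [cite: VignerasLNM800, Ch. II §1] [cite: Riehm1970, §2] -/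
theorem exists_mem_det_eq_of_fixed_unit (hD : IsRamifiedQuadraticDatum σ ϖ d t) (h2v : Valued.v (2 : K) < 1) (hσξ : σ ξ = ξ) (hξ1 : Valued.v ξ = 1)
    {G : Subgroup (GL (Fin 2) K)}
    (hG : ∀ g : GL (Fin 2) K, g ∈ G ↔
      ((g : Matrix (Fin 2) (Fin 2) K) 0 1 = ξ * σ ((g : Matrix (Fin 2) (Fin 2) K) 1 0) ∧ (g : Matrix (Fin 2) (Fin 2) K) 1 1 = σ ((g : Matrix (Fin 2) (Fin 2) K) 0 0) ∧
        Valued.v ((g : Matrix (Fin 2) (Fin 2) K) 0 0) ≤ 1 ∧ Valued.v ((g : Matrix (Fin 2) (Fin 2) K) 1 0) ≤ 1 ∧ Valued.v (g : Matrix (Fin 2) (Fin 2) K).det = 1))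
    {u : K} (hσu : σ u = u) (hu1 : Valued.v u = 1) :
    ∃ g : GL (Fin 2) K, g ∈ G ∧ (g : Matrix (Fin 2) (Fin 2) K).det = u := by
  have hD' := hD
  obtain ⟨hσ, hvσ, -, -, -, -, -⟩ := hD'
  have hu0 : u ≠ 0 := fun h => by rw [h, map_zero] at hu1; exact zero_ne_one hu1
  by_cases hun : ∃ z : K, z * σ z = u
  · obtain ⟨z, hz⟩ := hun
    have hz1 : Valued.v z = 1 := v_eq_one_of_v_mul_map_eq_one hvσ (by rw [hz, hu1])
    obtain ⟨g, hg, -, -, hgdet⟩ := exists_mem_diag hvσ hG hz1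
    exact ⟨g, hg, by rw [hgdet, hz]⟩
  · obtain ⟨g₀, hg₀, hg₀N⟩ := exists_mem_det_not_isNorm hD h2v hσξ hξ1 hG
    obtain ⟨hσt, ht1⟩ := det_fixed_of_mem hσ hσξ hG hg₀
    set t₀ := (g₀ : Matrix (Fin 2) (Fin 2) K).det with ht₀
    have ht0 : t₀ ≠ 0 := fun h => by rw [h, map_zero] at ht1; exact zero_ne_one ht1
    -- index two: `u ∉ N`, `t₀⁻¹ ∉ N` ⇒ `u·t₀⁻¹ ∈ N`
    obtain ⟨c₀, hσc₀, hc₀N, hdich⟩ := exists_nonnorm_dichotomy hD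
    have hc₀0 : c₀ ≠ 0 := by rintro rfl; exact hc₀N ⟨0, by rw [zero_mul]⟩
    have htinvN : ¬ ∃ z : K, z * σ z = t₀⁻¹ := by
      rintro ⟨z, hz⟩
      refine hg₀N ⟨z⁻¹, ?_⟩
      rw [map_inv₀, ← mul_inv, hz, inv_inv]
    obtain ⟨z₁, hz₁⟩ := (hdich u hσu hu0).resolve_left hun
    obtain ⟨z₂, hz₂⟩ := (hdich t₀⁻¹ (by rw [map_inv₀, hσt]) (inv_ne_zero ht0)).resolve_left htinvN
    have hz : (z₁ * z₂ / c₀) * σ (z₁ * z₂ / c₀) = u * t₀⁻¹ := by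
      rw [map_div₀, hσc₀, map_mul, div_mul_div_comm, show z₁ * z₂ * (σ z₁ * σ z₂) = (z₁ * σ z₁) * (z₂ * σ z₂) by ring, hz₁, hz₂]
      field_simp
    set z := z₁ * z₂ / c₀
    have hz1 : Valued.v z = 1 := v_eq_one_of_v_mul_map_eq_one hvσ (by rw [hz, map_mul, map_inv₀, hu1, ht1, inv_one, mul_one])
    obtain ⟨g, hg, -, -, hgdet⟩ := exists_mem_diag hvσ hG hz1
    refine ⟨g * g₀, G.mul_mem hg hg₀, ?_⟩
    rw [Units.val_mul, Matrix.det_mul, hgdet, hz, inv_mul_cancel_right₀ ht0]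

end DetImage

/-! ## §4 The reduced-norm image of the level `G_{4m} = 1 + 4Λ` is the fixed level `U_F^{(2m+⌊d∕2⌋)}` (`|2| = |ϖ|^{2m}`) -/

section LevelImage

variable {K : Type} [Field K] [Valued K ℤᵐ⁰] {σ : K →+* K} {ϖ ξ : K} {d t : ℕ}

/-- **`nrd(1 + 4Λ) ⊆ U_F^{(2m+⌊d∕2⌋)}`** (E-depth `4m + 2⌊d∕2⌋`): for `g = M(1+x, c) ∈ Λ^×` with `|x|, |c| ≤ exp(−4m)`, `det g − 1 = (x + σx) + xσx − ξ·cσc` and the trace term has the ★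
depth `Tr 𝔭_E^{4m} ⊆ 𝔭_F^{2m+⌊d∕2⌋}` (`v_add_map_le_exp`), while `|xσx|, |ξcσc| ≤ exp(−8m) ≤ exp(−(4m+2⌊d∕2⌋))` (`d ≤ t + 1 = 2m + 1`, ★ `d_le_succ_t`).
[cite: Serre1979, Ch. III §3 Prop. 7; Ch. V §3 Prop. 5] [cite: Riehm1970, §2] -/
theorem valued_det_sub_one_le_of_level (hD : IsRamifiedQuadraticDatum σ ϖ d t) (hξ1 : Valued.v ξ = 1) {m : ℕ} (htm : t = 2 * m)
    {G : Subgroup (GL (Fin 2) K)}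
    (hG : ∀ g : GL (Fin 2) K, g ∈ G ↔
      ((g : Matrix (Fin 2) (Fin 2) K) 0 1 = ξ * σ ((g : Matrix (Fin 2) (Fin 2) K) 1 0) ∧ (g : Matrix (Fin 2) (Fin 2) K) 1 1 = σ ((g : Matrix (Fin 2) (Fin 2) K) 0 0) ∧
        Valued.v ((g : Matrix (Fin 2) (Fin 2) K) 0 0) ≤ 1 ∧ Valued.v ((g : Matrix (Fin 2) (Fin 2) K) 1 0) ≤ 1 ∧ Valued.v (g : Matrix (Fin 2) (Fin 2) K).det = 1))
    {g : GL (Fin 2) K} (hg : g ∈ G) (ha : Valued.v ((g : Matrix (Fin 2) (Fin 2) K) 0 0 - 1) ≤ exp (-((4 * m : ℕ) : ℤ)))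
    (hc : Valued.v ((g : Matrix (Fin 2) (Fin 2) K) 1 0) ≤ exp (-((4 * m : ℕ) : ℤ))) :
    Valued.v ((g : Matrix (Fin 2) (Fin 2) K).det - 1) ≤ exp (-((4 * m + 2 * (d / 2) : ℕ) : ℤ)) := by
  have hD' := hD
  obtain ⟨hσ, hvσ, hϖ, hfix, hd, -, ht⟩ := hD'
  have hdt : d ≤ t + 1 := d_le_succ_t hσ hfix hϖ hd ht
  obtain ⟨h01, h11, -, -, -⟩ := (hG g).1 hg
  set a := (g : Matrix (Fin 2) (Fin 2) K) 0 0 with ha_def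
  set c := (g : Matrix (Fin 2) (Fin 2) K) 1 0 with hc_def
  set x := a - 1 with hx_def
  have hdet : (g : Matrix (Fin 2) (Fin 2) K).det - 1 = (x + σ x) + (x * σ x - ξ * (c * σ c)) := by
    rw [det_of_shape h01 h11, hx_def, map_sub, map_one]; ring
  have htr : Valued.v (x + σ x) ≤ exp (-(2 * ((2 * m + d / 2 : ℕ) : ℤ))) :=
    v_add_map_le_exp hσ hfix hϖ hd ht (x := x) (j := ((4 * m : ℕ) : ℤ)) (m := ((2 * m + d / 2 : ℕ) : ℤ)) ha (by push_cast; omega)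
  have hsq : ∀ y : K, Valued.v y ≤ exp (-((4 * m : ℕ) : ℤ)) → Valued.v (y * σ y) ≤ exp (-((4 * m + 2 * (d / 2) : ℕ) : ℤ)) := by
    intro y hy
    rw [map_mul, hvσ]
    calc Valued.v y * Valued.v y ≤ exp (-((4 * m : ℕ) : ℤ)) * exp (-((4 * m : ℕ) : ℤ)) := mul_le_mul' hy hy
      _ ≤ exp (-((4 * m + 2 * (d / 2) : ℕ) : ℤ)) := by rw [← exp_add, exp_le_exp]; push_cast; omega
  rw [hdet]
  refine (Valuation.map_add _ _ _).trans (max_le (htr.trans_eq ?_) ((Valuation.map_sub _ _ _).trans (max_le (hsq x ha) ?_)))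
  · congr 1; push_cast; ring
  · rw [map_mul, hξ1, one_mul]; exact hsq c hc

/-- **`U_F^{(2m+⌊d∕2⌋)} ⊆ nrd(1 + 4Λ)`, ON THE TORUS** (`|2| = |ϖ|^{2m}`, `m ≥ 1`): every `σ`-fixed unit `u` with `|u − 1| ≤ exp(−(4m + 2⌊d∕2⌋))` is `det M(z, 0) = zσz` for a `z` with
`|z − 1| ≤ exp(−4m)` — Serre's `ψ(n) = 2n − d + 1` through ★ `exists_mul_map_eq_of_isRamifiedQuadraticDatum` (`4m + 2⌊d∕2⌋ ≥ 2d` and `4m + 2⌊d∕2⌋ + 1 − d ≥ 4m`).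
[cite: Serre1979, Ch. V §3 Prop. 5, Cor. 3] [cite: Riehm1970, §2] -/
theorem exists_mem_level_det_eq_of_fixed_unit_level [CompleteSpace K] (hD : IsRamifiedQuadraticDatum σ ϖ d t) {m : ℕ} (htm : t = 2 * m) (hm1 : 1 ≤ m)
    {G : Subgroup (GL (Fin 2) K)}
    (hG : ∀ g : GL (Fin 2) K, g ∈ G ↔
      ((g : Matrix (Fin 2) (Fin 2) K) 0 1 = ξ * σ ((g : Matrix (Fin 2) (Fin 2) K) 1 0) ∧ (g : Matrix (Fin 2) (Fin 2) K) 1 1 = σ ((g : Matrix (Fin 2) (Fin 2) K) 0 0) ∧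
        Valued.v ((g : Matrix (Fin 2) (Fin 2) K) 0 0) ≤ 1 ∧ Valued.v ((g : Matrix (Fin 2) (Fin 2) K) 1 0) ≤ 1 ∧ Valued.v (g : Matrix (Fin 2) (Fin 2) K).det = 1))
    {u : K} (hσu : σ u = u) (hul : Valued.v (u - 1) ≤ exp (-((4 * m + 2 * (d / 2) : ℕ) : ℤ))) :
    ∃ g : GL (Fin 2) K, g ∈ G ∧ Valued.v ((g : Matrix (Fin 2) (Fin 2) K) 0 0 - 1) ≤ exp (-((4 * m : ℕ) : ℤ)) ∧
      Valued.v ((g : Matrix (Fin 2) (Fin 2) K) 1 0) ≤ exp (-((4 * m : ℕ) : ℤ)) ∧ (g : Matrix (Fin 2) (Fin 2) K).det = u := by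
  have hD' := hD
  obtain ⟨hσ, hvσ, hϖ, hfix, hd, -, ht⟩ := hD'
  have hdt : d ≤ t + 1 := d_le_succ_t hσ hfix hϖ hd ht
  haveI := isAdicComplete_valuedInteger_of_completeSpace hϖ
  -- Serre's `ψ`: a norm preimage with controlled level
  have hu2d : Valued.v (u - 1) ≤ Valued.v ϖ ^ (2 * d) := by
    refine hul.trans ?_
    rw [v_varpi_pow hϖ, exp_le_exp]; push_cast; omega
  obtain ⟨z, hz, hzl⟩ := exists_mul_map_eq_of_isRamifiedQuadraticDatum σ ϖ d t hD u hσu hu2d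
  have hz1lev : Valued.v (z - 1) ≤ exp (-((4 * m : ℕ) : ℤ)) := by
    rcases eq_or_ne (z - 1) 0 with h0 | h0
    · rw [h0, map_zero]; exact zero_le
    · obtain ⟨k, hk⟩ : ∃ k : ℤ, Valued.v (z - 1) = exp k := ⟨_, (exp_log ((Valuation.ne_zero_iff _).2 h0)).symm⟩
      have h2 : Valued.v (u - 1) * Valued.v ϖ ≤ exp (-((4 * m + 2 * (d / 2) : ℕ) : ℤ)) * exp (-1 : ℤ) := by rw [hϖ]; exact mul_le_mul_left hul _
      have h3 := hzl.trans h2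
      rw [hk, v_varpi_pow hϖ, ← exp_add, ← exp_add, exp_le_exp] at h3
      rw [hk, exp_le_exp]
      push_cast at h3 ⊢
      omega
  have hu1 : Valued.v u = 1 := by
    have h : Valued.v (u - 1) < 1 := lt_of_le_of_lt hul (by rw [← exp_zero, exp_lt_exp]; push_cast; omega)
    have := Valuation.map_one_add_of_lt _ h
    rwa [add_sub_cancel] at this
  have hz1 : Valued.v z = 1 := v_eq_one_of_v_mul_map_eq_one hvσ (by rw [hz, hu1])
  obtain ⟨g, hg, hg00, hg10, hgdet⟩ := exists_mem_diag hvσ hG hz1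
  refine ⟨g, hg, by rw [hg00]; exact hz1lev, by rw [hg10, map_zero]; exact zero_le, by rw [hgdet, hz]⟩

end LevelImage

end Summit.HodgeConjecture.HodgeConjecture.Cruxes.H413.K2E3WildOrderUnitGroupNormImage

end
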